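import Summits.KontsevichZagierPeriods.KontsevichZagierPeriods.Theorems.PentagonInKZ.Negative.EvalInstance

/-!
# `PentagonInKZ` (stmt-KontsevichZagierPeriods-11348) — negative knowledge, part 3: exact weight-3 and weight-4 content in every realisation

What the crux `FurushoPentagon.PentagonInKZ` forces in EVERY realisation `χ` of the rules (from
the landed weight-3 / weight-4 analyses of the pentagon, `NCSeries.DrinfeldPentagon.apply_weight_three`
/ `apply_weight_four`, fed with the low-weight coefficients of the crux series; the regularised
values `reg_ш(xx) = reg_ш(yy) = 0`, `reg_ш(yx) = -xy` are computed here):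
weight 3 `χ⟦ζ(3)⟧ = χ⟦ζ(2,1)⟧` (`weight_three_content`); weight 4 `5χ⟦ζ(4)⟧ = 2χ⟦ζ(2)⟧²`,
`10χ⟦ζ(3,1)⟧ = χ⟦ζ(2)⟧²`, `10χ⟦ζ(2,2)⟧ = 3χ⟦ζ(2)⟧²`, `5χ⟦ζ(2,1,1)⟧ = 2χ⟦ζ(2)⟧²`
(`weight_four_content`), hence `χ⟦ζ(4)⟧ = 4χ⟦ζ(3,1)⟧` (item 0275 ⊗ ℚ), weight-4 duality, the
weight-4 STUFFLE `χ⟦ζ(2)⟧² = 2χ⟦ζ(2,2)⟧ + χ⟦ζ(4)⟧` and SHUFFLE.  A realisation violating any of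
these refutes the crux (and, by part 4, Conjecture 1). [cite: Furusho2011, §2; BarNatan1998; Zagier1994, §9]
-/

noncomputable section

open Literature.NumberTheory.Transcendental

namespace Summit.KontsevichZagierPeriods.FurushoPentagon.PentagonInKZNegative

open Summit.KontsevichZagierPeriods.KontsevichZagierPeriods.Theses.FurushoPentagon (PentagonInKZ)

/-! ## §5 Exact low-weight content of the crux in every realisation -/

/-- **Weight-3 content**: the crux implies `χ(Z [3]) = χ(Z [2,1])` (Euler's `ζ(3) = ζ(2,1)`) in
EVERY realisation — the pentagon's weight-3 consequence `c_{xxy} + c_{xyy} = 0`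
(`NCSeries.DrinfeldPentagon.apply_weight_three`). A realisation separating `⟦ζ(3)⟧` from
`⟦ζ(2,1)⟧` would refute the crux (and Conjecture 1). [cite: Furusho2011, §2] -/
theorem weight_three_content (h : PentagonInKZ) (R : Type) [CommRing R] [Algebra ℚ R]
    (χ : KZ.FormalRep →+ R) (hχ : IsRealisation R χ) (Z : List ℕ → KZ.FormalRep)
    (hZ : AgreesWithSimplex Z) : χ (Z [3]) = χ (Z [2, 1]) := by
  have hp := (pentagonInKZ_iff'.mp h) R χ hχ Z hZ
  have h3 := NCSeries.DrinfeldPentagon.apply_weight_three hp (cruxSeries_nil_eq_one χ Z hχ hZ)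
    (cruxSeries_x χ Z) (cruxSeries_y χ Z)
  rw [cruxSeries_xxy, cruxSeries_xyy, neg_add_eq_zero] at h3
  exact h3


/-! ## §8 Weight-four content of the crux in every realisation -/

section WeightFour

/-- `x ш x = 2·xx`. [cite: IharaKanekoZagier2006, §1] -/
theorem shuffleSum_x_x : MZV.shuffleSum [false] [false] = Finsupp.single [false, false] 2 := by
  rw [MZV.shuffleSum_cons_cons, MZV.shuffleSum_nil_left, MZV.shuffleSum_nil_right]
  simp [Finsupp.mapDomain_single, ← Finsupp.single_add]
  norm_num

/-- `y ш y = 2·yy`. [cite: IharaKanekoZagier2006, §1] -/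
theorem shuffleSum_y_y : MZV.shuffleSum [true] [true] = Finsupp.single [true, true] 2 := by
  rw [MZV.shuffleSum_cons_cons, MZV.shuffleSum_nil_left, MZV.shuffleSum_nil_right]
  simp [Finsupp.mapDomain_single, ← Finsupp.single_add]
  norm_num

/-- `regEnd(xx) = xx − x ш x + xx ш ∅ = 0`. [cite: IharaKanekoZagier2006, Cor. 5] -/
theorem regEnd_xx : MZV.regEnd [false, false] = 0 := by
  have ht : MZV.trailingX [false, false] = 2 := by decide
  rw [MZV.regEnd, ht]
  simp only [Finset.sum_range_succ, Finset.range_zero, Finset.sum_empty, zero_add, pow_zero,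
    one_smul, pow_one, List.length_cons, List.length_nil, List.replicate, List.take,
    MZV.shuffleSum_nil_left, shuffleSum_x_x]
  norm_num
  rw [← Finsupp.single_neg, ← Finsupp.single_add, ← Finsupp.single_add]
  norm_num

/-- **`reg_ш(xx) = 0`.** [cite: IharaKanekoZagier2006, §3] -/
theorem shuffleReg_xx : MZV.shuffleReg [false, false] = 0 := by
  rw [MZV.shuffleReg, regEnd_xx, Finsupp.sum_zero_index]

/-- `regFront(yy) = yy − y ш y + yy = 0`. [cite: IharaKanekoZagier2006, Cor. 5] -/
theorem regFront_yy : MZV.regFront [true, true] = 0 := by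
  have hl : MZV.leadingY [true, true] = 2 := by decide
  rw [MZV.regFront, hl]
  simp only [Finset.sum_range_succ, Finset.range_zero, Finset.sum_empty, zero_add, pow_zero,
    one_smul, pow_one, List.replicate, List.drop,
    MZV.shuffleSum_nil_left, MZV.shuffleSum_nil_right, shuffleSum_y_y]
  norm_num
  rw [← Finsupp.single_neg, ← Finsupp.single_add, ← Finsupp.single_add]
  norm_num

/-- **`reg_ш(yy) = 0`.** [cite: IharaKanekoZagier2006, §3] -/
theorem shuffleReg_yy : MZV.shuffleReg [true, true] = 0 := by
  have ht : MZV.trailingX [true, true] = 0 := by decide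
  rw [MZV.shuffleReg, MZV.regEnd_of_trailingX_eq_zero ht, Finsupp.sum_single_index (by simp),
    one_smul, regFront_yy]

variable {R : Type} [CommRing R] [Algebra ℚ R] (χ : KZ.FormalRep →+ R) (Z : List ℕ → KZ.FormalRep)

/-- `Φ_χ(X₀X₀) = 0`. [cite: IharaKanekoZagier2006, §3] -/
theorem cruxSeries_xx : cruxSeries R χ Z [false, false] = 0 := by
  simp [cruxSeries, shuffleReg_xx]

/-- `Φ_χ(X₁X₁) = 0`. [cite: IharaKanekoZagier2006, §3] -/
theorem cruxSeries_yy : cruxSeries R χ Z [true, true] = 0 := by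
  simp [cruxSeries, shuffleReg_yy]

/-- `Φ_χ(X₀X₁) = -χ(Z [2])`. [cite: Furusho2003, Prop. 3.2.3] -/
theorem cruxSeries_xy : cruxSeries R χ Z [false, true] = -χ (Z [2]) := by
  rw [cruxSeries_of_isConvergentWord χ Z (Or.inr ⟨rfl, rfl⟩)]
  have : MZV.ofBinaryWord [false, true] = [2] := by decide
  simp [this]

/-- `Φ_χ(X₁X₀) = +χ(Z [2])` (a genuinely regularised coefficient: `reg(yx) = -xy`).
[cite: Furusho2003, Prop. 3.2.3] -/
theorem cruxSeries_yx : cruxSeries R χ Z [true, false] = χ (Z [2]) := by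
  rw [cruxSeries, MZV.shuffleReg_yx, Finsupp.sum_neg_index (by simp),
    Finsupp.sum_single_index (by simp)]
  have : MZV.ofBinaryWord [false, true] = [2] := by decide
  simp [this, MZV.IsConvergentWord]

/-- `Φ_χ(X₀X₀X₀X₁) = -χ(Z [4])`. [cite: Furusho2003, Prop. 3.2.3] -/
theorem cruxSeries_xxxy : cruxSeries R χ Z [false, false, false, true] = -χ (Z [4]) := by
  rw [cruxSeries_of_isConvergentWord χ Z (Or.inr ⟨rfl, rfl⟩)]
  have : MZV.ofBinaryWord [false, false, false, true] = [4] := by decide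
  simp [this]

/-- `Φ_χ(X₀X₀X₁X₁) = χ(Z [3,1])`. [cite: Furusho2003, Prop. 3.2.3] -/
theorem cruxSeries_xxyy : cruxSeries R χ Z [false, false, true, true] = χ (Z [3, 1]) := by
  rw [cruxSeries_of_isConvergentWord χ Z (Or.inr ⟨rfl, rfl⟩)]
  have : MZV.ofBinaryWord [false, false, true, true] = [3, 1] := by decide
  simp [this]

/-- `Φ_χ(X₀X₁X₀X₁) = χ(Z [2,2])`. [cite: Furusho2003, Prop. 3.2.3] -/
theorem cruxSeries_xyxy : cruxSeries R χ Z [false, true, false, true] = χ (Z [2, 2]) := by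
  rw [cruxSeries_of_isConvergentWord χ Z (Or.inr ⟨rfl, rfl⟩)]
  have : MZV.ofBinaryWord [false, true, false, true] = [2, 2] := by decide
  simp [this]

/-- `Φ_χ(X₀X₁X₁X₁) = -χ(Z [2,1,1])`. [cite: Furusho2003, Prop. 3.2.3] -/
theorem cruxSeries_xyyy : cruxSeries R χ Z [false, true, true, true] = -χ (Z [2, 1, 1]) := by
  rw [cruxSeries_of_isConvergentWord χ Z (Or.inr ⟨rfl, rfl⟩)]
  have : MZV.ofBinaryWord [false, true, true, true] = [2, 1, 1] := by decide
  simp [this]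
  ring

variable {χ Z}

/-- **Weight-4 content**: in EVERY realisation the crux forces
`5χ⟦ζ(4)⟧ = 2χ⟦ζ(2)⟧²`, `10χ⟦ζ(3,1)⟧ = χ⟦ζ(2)⟧²`, `10χ⟦ζ(2,2)⟧ = 3χ⟦ζ(2)⟧²`,
`5χ⟦ζ(2,1,1)⟧ = 2χ⟦ζ(2)⟧²` — i.e. ALL weight-4 MZV relations (Euler's evaluation
`ζ(4) = 2ζ(2)²/5` included) hold for the classes, rationally (from the landed
`NCSeries.DrinfeldPentagon.apply_weight_four`).  So a proof of the crux proves, at its second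
rung, the weight-4 stuffle AND `ζ(4) = 4ζ(3,1)` (item 0275) inside `P ⊗ ℚ`.
[cite: Furusho2011, §2; BarNatan1998] -/
theorem weight_four_content (h : PentagonInKZ) (hχ : IsRealisation R χ)
    (hZ : AgreesWithSimplex Z) :
    5 * χ (Z [4]) = 2 * χ (Z [2]) ^ 2 ∧ 10 * χ (Z [3, 1]) = χ (Z [2]) ^ 2 ∧
      10 * χ (Z [2, 2]) = 3 * χ (Z [2]) ^ 2 ∧ 5 * χ (Z [2, 1, 1]) = 2 * χ (Z [2]) ^ 2 := by
  have hp := (pentagonInKZ_iff'.mp h) R χ hχ Z hZ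
  have h4 := NCSeries.DrinfeldPentagon.apply_weight_four hp (cruxSeries_nil_eq_one χ Z hχ hZ)
    (cruxSeries_x χ Z) (cruxSeries_y χ Z) (cruxSeries_xx χ Z) (cruxSeries_yy χ Z)
    (by rw [cruxSeries_yx, cruxSeries_xy, neg_neg])
  rw [cruxSeries_xxxy, cruxSeries_xxyy, cruxSeries_xyxy, cruxSeries_xyyy, cruxSeries_xy] at h4
  obtain ⟨h1, h2, h3, h4⟩ := h4
  exact ⟨by linear_combination -h1, by linear_combination h2, by linear_combination h3,
    by linear_combination -h4⟩

/-- **The crux implies item 0275 rationally**: `χ⟦ζ(4)⟧ = 4χ⟦ζ(3,1)⟧` in every realisation.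
[cite: Zagier1994, §9] -/
theorem zeta4_eq_four_zeta31 (h : PentagonInKZ) (hχ : IsRealisation R χ)
    (hZ : AgreesWithSimplex Z) : χ (Z [4]) = 4 * χ (Z [3, 1]) := by
  obtain ⟨h1, h2, -, -⟩ := weight_four_content h hχ hZ
  have h5 : (5 : R) * (χ (Z [4]) - 4 * χ (Z [3, 1])) = 0 := by linear_combination h1 - 2 * h2
  have hu := NCSeries.isUnit_natCast_of_ne_zero (S := R) (n := 5) (by norm_num)
  rw [Nat.cast_ofNat] at hu
  exact sub_eq_zero.mp (hu.mul_right_eq_zero.mp h5)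

/-- **The crux implies weight-4 duality** `χ⟦ζ(4)⟧ = χ⟦ζ(2,1,1)⟧`. [cite: Zagier1994, §9] -/
theorem zeta4_eq_zeta211 (h : PentagonInKZ) (hχ : IsRealisation R χ)
    (hZ : AgreesWithSimplex Z) : χ (Z [4]) = χ (Z [2, 1, 1]) := by
  obtain ⟨h1, -, -, h4⟩ := weight_four_content h hχ hZ
  have h5 : (5 : R) * (χ (Z [4]) - χ (Z [2, 1, 1])) = 0 := by linear_combination h1 - h4
  have hu := NCSeries.isUnit_natCast_of_ne_zero (S := R) (n := 5) (by norm_num)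
  rw [Nat.cast_ofNat] at hu
  exact sub_eq_zero.mp (hu.mul_right_eq_zero.mp h5)

/-- **The crux implies the weight-4 STUFFLE** `χ⟦ζ(2)⟧² = 2χ⟦ζ(2,2)⟧ + χ⟦ζ(4)⟧` (the first
non-dissection relation, item StuffleInKZ at `s = t = (2)`, rationally). [cite: Hoffman1997, §2] -/
theorem weight_four_stuffle (h : PentagonInKZ) (hχ : IsRealisation R χ)
    (hZ : AgreesWithSimplex Z) : χ (Z [2]) ^ 2 = 2 * χ (Z [2, 2]) + χ (Z [4]) := by
  obtain ⟨h1, -, h3, -⟩ := weight_four_content h hχ hZ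
  have h5 : (5 : R) * (χ (Z [2]) ^ 2 - (2 * χ (Z [2, 2]) + χ (Z [4]))) = 0 := by
    linear_combination -h1 - h3
  have hu := NCSeries.isUnit_natCast_of_ne_zero (S := R) (n := 5) (by norm_num)
  rw [Nat.cast_ofNat] at hu
  exact sub_eq_zero.mp (hu.mul_right_eq_zero.mp h5)

/-- **The crux implies the weight-4 SHUFFLE** `χ⟦ζ(2)⟧² = 2χ⟦ζ(2,2)⟧ + 4χ⟦ζ(3,1)⟧` (what
ShuffleIsDissection gives at `s = t = (2)`), rationally. [cite: IharaKanekoZagier2006, §1] -/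
theorem weight_four_shuffle (h : PentagonInKZ) (hχ : IsRealisation R χ)
    (hZ : AgreesWithSimplex Z) : χ (Z [2]) ^ 2 = 2 * χ (Z [2, 2]) + 4 * χ (Z [3, 1]) := by
  obtain ⟨-, h2, h3, -⟩ := weight_four_content h hχ hZ
  have h5 : (5 : R) * (χ (Z [2]) ^ 2 - (2 * χ (Z [2, 2]) + 4 * χ (Z [3, 1]))) = 0 := by
    linear_combination -h3 - 2 * h2
  have hu := NCSeries.isUnit_natCast_of_ne_zero (S := R) (n := 5) (by norm_num)
  rw [Nat.cast_ofNat] at hu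
  exact sub_eq_zero.mp (hu.mul_right_eq_zero.mp h5)

end WeightFour


end Summit.KontsevichZagierPeriods.FurushoPentagon.PentagonInKZNegative
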